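import Summits.QuantumFields.BalabanUV.T4Continuum.Support.NE3CovariantLineAdjointFrame
import Summits.QuantumFields.BalabanUV.T4Continuum.Support.NE3BlockPoincareLocal
import Summits.QuantumFields.BalabanUV.T4Continuum.Support.NE3CombGaugeLine
import Summits.QuantumFields.BalabanUV.T4Continuum.Support.NE3NearIdentityGradient
import Summits.QuantumFields.BalabanUV.T4Continuum.Support.NE3CovariantBlockPoincare
import HarnessLib

/-!
# T⁴ programme, node NE3 — route H♮ row K4, item K4-d1 «THE CORE AT W», file 1∕2: Hilbert–Schmidt bookkeeping, the LOCAL flat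
# core in HS currency, gauge covariance of the corner-read comb line sum, and the `κ`-last comb transports in row C0's `κ`-FIRST
# comb gauge

NE3 formalisation swarm `b2b-balaban-t4-ne3-formalise-*`, LEAF PROVER 03 (unit `b2b-balaban-t4-ne3-formalise-leaf-03`, gen 8; cell
`pub-balaban`); row **K4** of the owner's ruling ρ-g22-2 (journal l.17514) and SHAPE K4 (l.17848), item **K4-d** «THE CORE AT W» — its
K4-c-independent half K4-d1 (INTENT ∕ CLAIM journal l.18665).  File 2 = `NE3CovariantLineSumCore` (the core itself and its torus sums).

WHY.  SHAPE K4's item K4-d asks for (71S) §1 (`NE3BlockPoincareLandau.sum_norm_sq_le_of_lineSum_sq_le`: `Σ‖Y‖² ≤ (5+4Θ)M²·G` from a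
bound on the block-line sums) «transported to W per double block in comb gauge», with covariant gradients and a remainder
`C·(M²a)²·Σ‖η‖²`.  The flat core — leaf-04's LOCAL form `NE3BlockPoincareLocal.sum_block_norm_sq_le` (one block, one component, every
cochain, the line sum kept explicit) — speaks ℂ-valued cochains and FLAT forward differences; the curved statement speaks matrix-valued
directions, the covariant differences `covFd W η` of row NE3-R2's (γ2) `AveragingDeficitCovGrad`, and the corner-read comb line sum of
record `TWg M (combFrame W M) η` (= K4-a's `TWc L k W η` at `M = L^k`).  THIS FILE supplies the three bridges; file 2 assembles them.
§1 HS BOOKKEEPING: `nhsNormSq_sum_le_card_mul` (`‖Σ_{i∈s} X i‖²_HS ≤ #s·Σ‖X i‖²_HS`) and **`sum_block_nhsNormSq_le`** = the entrywise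
   lift of the local flat core to matrix fields (normalised Hilbert–Schmidt currency = the `hsR` world of K4-a∕b∕c; `card n` cancels);
§2 GAUGE: **`TWg_combFrame_gaugeAct`** — for EVERY gauge transformation `u`,
   `TWg M (combFrame (W^u) M) (η^u) z κ = Ad (u (M•z)) (TWg M (combFrame W M) η z κ)` (`η^u = dirGauge u η` lives at the END of its bond,
   where the `u`-factors of `hol_gaugeAct` cancel), so `‖TWc‖_HS` is gauge invariant; and the pointwise twin of leaf-03-g6's C5
   `NE3NearIdentityGradient.nhsNormSq_fd_le` with HS remainders (`AveragingDeficitHSInner.nhsNorm_Ad_sub_le`; no operator norm of `η`,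
   no `card n`): **`nhsNormSq_fd_dirGauge_le_hs`**
   `‖η^u(x+e_μ)ν − η^u x ν‖²_HS ≤ 2‖covFd W η x μ ν‖²_HS + 64α²‖η(x+e_μ)ν‖²_HS + 16α²‖η x ν‖²_HS` when the three gauge-fixed bonds are `α`-close to `1`;
§3 THE GAUGE = row C0 file 3's `κ`-FIRST comb `u = NE3CombGaugeLine.lcomb κ M W z` (bond bounds `norm_lcombGauge_sub_one_le(_self)`,
   UNIFORM ALONG THE `κ`-LINE, BY NAME): the transverse tree at the corner height is trivial in the gauge (`lineWord κ t = treeWord t` for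
   `t κ = 0`), the `κ`-segments cost `(d−1)(M−1)a` per bond (`hol_seg_succ` + C5's `norm_mul_sub_one_le`), hence the `κ`-LAST comb
   transports of the gauge-fixed background obey **`norm_combTransport_lcombGauge_sub_one_le`**
   `‖combTransport (W^u) M z κ v (i+1) − 1‖ ≤ 2M·(d−1)(M−1)·a` (`v ∈ [0,M)^d`, `i < M`), and the far `κ`-bonds one layer beyond a
   transverse face cost `(d−1)·M·a` (`norm_lcombGauge_far_sub_one_le`).
All [folklore]; 0 sorry; 0 `def`; every object BY NAME.

HONEST FRAMING.  Lattice bookkeeping and row C0's quoted comb bounds on OUR typed objects at ONE configuration; no estimate of NE3's;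
nothing about Bałaban's minimisers; (P♮)_W, (ML_w) at W ≠ 1, T-E_w and NE3 are NOT proved; spine PROVED 0∕9; finite T⁴ rung (B)+1 —
NOT infinite volume, NOT mass gap, NOT BetaPertH, NOT Clay.  ABSOLUTE RULE kept (nothing printed is a hypothesis; context only:
[Balaban1985Averaging] (8) p. 18, pp. 24–25, (44) p. 24).  PLACEMENT: `Summits/QuantumFields/BalabanUV/`; imports accepted modules only
(K4-a file 2 p228795, leaf-04's `NE3BlockPoincareLocal` p222017 and K2 `NE3CovariantBlockPoincare` p229327 — for `nhsNormSq_Ad_sub_le` —, C0 file 3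
`NE3CombGaugeLine` p223473, C5 `NE3NearIdentityGradient` p224077).
HONEST DEPENDENCY (cell page 1): continuum YM on T⁴ ⇐ BetaPertH ∧ nine spine estimates (0/9 proved); BetaPertH ⇐ (D1) ∧ (D4) ∧ CAP+tail;
G-an2-4 gates asym, D1 and NE2/3/4.
-/

set_option autoImplicit false

open scoped BigOperators Matrix Matrix.Norms.L2Operator
open NormedSpace Finset

namespace Summit.QuantumFields.BalabanUV.T4Continuum.NE3CovariantLineSumCore

open Literature.MathematicalPhysics.QuantumFieldTheory.Balaban1983to89
open B7Prop1Explicit B7Prop2Explicit MatrixLog UnitaryModel MatrixNorms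
open T4AveragingDeficitWall (IsUnitaryCfg SmallField Ad)
open T4AveragingDeficitWallBoundary (periodBox mem_periodBox card_periodBox sum_periodBox_shift IsPeriodicCfg)
open T4AveragingDeficitNonAbelian (Ad_mul Ad_sub)
open AveragingDeficitTransport (norm_Ad_of_unitary mem_U1_of_unitary)
open AveragingDeficitNearIdentity (Ad_one Ad_sum norm_Ad_sub_le)
open AveragingDeficitLocality (dirGauge)
open AveragingDeficitCovGrad (covFd covFd_gaugeAct)
open AveragingDeficitHSInner (nhsNormSq_Ad nhsNorm_Ad_sub_le)
open NE3CovariantCalculus (nhsNormSq_sub_le nhsNormSq_neg)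
open NE3NearIdentityGradient (norm_mul_sub_one_le)
open NE3CombGaugeLine (lineWord lcomb lcomb_corner lcomb_mem norm_lcombGauge_sub_one_le norm_lcombGauge_sub_one_le_self
  l1_transverse_le isUnitaryCfg_lcombGauge transverse_apply_self transverse_apply_ne)
open NE3CovariantLineAdjoint (TWg klastWord disp_klastWord combTransport combFrame Ad_combFrame_inv TWc)
open NE3BlockPoincareCore (sum_rotate3 sum_rotate4 sum_blocks_torus sum_blocks_torus_shift)
open NE3BlockPoincareLocal (sum_block_norm_sq_le)
open NE3CovariantBlockPoincare (nhsNormSq_Ad_sub_le)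

noncomputable section

variable {d : ℕ} {n : Type*} [Fintype n] [DecidableEq n]

/-! ## §1 Hilbert–Schmidt bookkeeping: Cauchy–Schwarz for `nhsNormSq` and the entrywise lift of the local flat core -/

omit [DecidableEq n] in
/-- `Σ_p Σ_q ‖X p q‖² = card n · nhsNormSq X`. [folklore] -/
theorem sum_sum_norm_apply_sq [Nonempty n] (X : Matrix n n ℂ) :
    ∑ p, ∑ q, ‖X p q‖ ^ 2 = Fintype.card n * nhsNormSq X := (card_mul_nhsNormSq X).symm

omit [DecidableEq n] in
/-- **CAUCHY–SCHWARZ IN THE NORMALISED HILBERT–SCHMIDT CURRENCY**: `nhsNormSq (Σ_{i∈s} X i) ≤ #s · Σ_{i∈s} nhsNormSq (X i)`.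
[folklore] -/
theorem nhsNormSq_sum_le_card_mul [Nonempty n] {ι : Type*} (s : Finset ι) (X : ι → Matrix n n ℂ) :
    nhsNormSq (∑ i ∈ s, X i) ≤ s.card * ∑ i ∈ s, nhsNormSq (X i) := by
  have hn : (0 : ℝ) < Fintype.card n := by exact_mod_cast Fintype.card_pos
  have hent : ∀ p q : n, ‖(∑ i ∈ s, X i) p q‖ ^ 2 ≤ s.card * ∑ i ∈ s, ‖X i p q‖ ^ 2 := by
    intro p q
    rw [Matrix.sum_apply]
    have h1 : ‖∑ i ∈ s, X i p q‖ ≤ ∑ i ∈ s, ‖X i p q‖ := norm_sum_le _ _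
    have h2 : (∑ i ∈ s, ‖X i p q‖) ^ 2 ≤ s.card * ∑ i ∈ s, ‖X i p q‖ ^ 2 := by
      exact_mod_cast sq_sum_le_card_mul_sum_sq (s := s) (f := fun i => ‖X i p q‖)
    exact (pow_le_pow_left₀ (norm_nonneg _) h1 2).trans h2
  have hsum := Finset.sum_le_sum fun p (_ : p ∈ (univ : Finset n)) =>
    Finset.sum_le_sum fun q (_ : q ∈ (univ : Finset n)) => hent p q
  rw [sum_sum_norm_apply_sq] at hsum
  simp only [← Finset.mul_sum] at hsum
  rw [sum_rotate3 univ univ s (fun p q i => ‖X i p q‖ ^ 2)] at hsum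
  simp only [sum_sum_norm_apply_sq, ← Finset.mul_sum] at hsum
  rw [mul_left_comm] at hsum
  exact le_of_mul_le_mul_left hsum hn

omit [DecidableEq n] in
/-- **THE LOCAL FLAT CORE IN THE HILBERT–SCHMIDT CURRENCY** (entrywise lift of leaf-04's
`NE3BlockPoincareLocal.sum_block_norm_sq_le` to matrix-valued 1-cochains; one block `B_M(M•z)`, one component `κ`, EVERY `Y`,
`M ≥ 1`): `M²·M^d·Σ_{v∈B} ‖Y(M•z+v,κ)‖²_HS ≤ M²·M^d·(M²·OSC) + 4·(M²·M^d·M·SEG) + 4·‖Σ_vΣ_{i<M} Y(M•z+v+ie_κ,κ)‖²_HS`. [folklore] -/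
theorem sum_block_nhsNormSq_le [Nonempty n] {M : ℕ} (hM : 1 ≤ M) (Y : Site d → Fin d → Matrix n n ℂ) (z : Site d) (κ : Fin d) :
    (M : ℝ) ^ 2 * (M : ℝ) ^ d * ∑ v ∈ periodBox (d := d) M, nhsNormSq (Y ((M : ℤ) • z + v) κ)
      ≤ (M : ℝ) ^ 2 * (M : ℝ) ^ d
            * ((M : ℝ) ^ 2 * ∑ v ∈ periodBox (d := d) M, ∑ μ : Fin d, nhsNormSq (Y ((M : ℤ) • z + v + e μ) κ - Y ((M : ℤ) • z + v) κ))
        + 4 * ((M : ℝ) ^ 2 * ((M : ℝ) ^ d * M)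
            * ∑ v ∈ periodBox (d := d) M, ∑ j ∈ range M,
                nhsNormSq (Y ((M : ℤ) • z + v + ((j : ℤ) + 1) • e κ) κ - Y ((M : ℤ) • z + v + (j : ℤ) • e κ) κ))
        + 4 * nhsNormSq (∑ v ∈ periodBox (d := d) M, ∑ i ∈ range M, Y ((M : ℤ) • z + v + (i : ℤ) • e κ) κ) := by
  have hn : (0 : ℝ) < Fintype.card n := by exact_mod_cast Fintype.card_pos
  set B : Finset (Site d) := periodBox (d := d) M with hB
  set q : Site d := (M : ℤ) • z with hq
  have hent : ∀ p p' : n,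
      (M : ℝ) ^ 2 * (M : ℝ) ^ d * ∑ v ∈ B, ‖(Y (q + v) κ) p p'‖ ^ 2
        ≤ (M : ℝ) ^ 2 * (M : ℝ) ^ d * ((M : ℝ) ^ 2 * ∑ v ∈ B, ∑ μ : Fin d, ‖(Y (q + v + e μ) κ - Y (q + v) κ) p p'‖ ^ 2)
          + 4 * ((M : ℝ) ^ 2 * ((M : ℝ) ^ d * M)
              * ∑ v ∈ B, ∑ j ∈ range M, ‖(Y (q + v + ((j : ℤ) + 1) • e κ) κ - Y (q + v + (j : ℤ) • e κ) κ) p p'‖ ^ 2)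
          + 4 * ‖(∑ v ∈ B, ∑ i ∈ range M, Y (q + v + (i : ℤ) • e κ) κ) p p'‖ ^ 2 := by
    intro p p'
    have h := sum_block_norm_sq_le hM (fun y ν => Y y ν p p') z κ
    simpa only [Matrix.sub_apply, Matrix.sum_apply] using h
  have hsum := Finset.sum_le_sum fun p (_ : p ∈ (univ : Finset n)) =>
    Finset.sum_le_sum fun p' (_ : p' ∈ (univ : Finset n)) => hent p p'
  simp only [Finset.sum_add_distrib, ← Finset.mul_sum] at hsum
  rw [sum_rotate3 univ univ B (fun p p' v => ‖(Y (q + v) κ) p p'‖ ^ 2),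
    sum_rotate4 univ univ B univ (fun p p' v μ => ‖(Y (q + v + e μ) κ - Y (q + v) κ) p p'‖ ^ 2),
    sum_rotate4 univ univ B (range M) (fun p p' v j => ‖(Y (q + v + ((j : ℤ) + 1) • e κ) κ - Y (q + v + (j : ℤ) • e κ) κ) p p'‖ ^ 2),
    sum_sum_norm_apply_sq] at hsum
  simp only [sum_sum_norm_apply_sq, ← Finset.mul_sum] at hsum
  have e1 : ∀ (A O S T : ℝ),
      Fintype.card n * ((M : ℝ) ^ 2 * (M : ℝ) ^ d * A)
        ≤ Fintype.card n * ((M : ℝ) ^ 2 * (M : ℝ) ^ d * ((M : ℝ) ^ 2 * O) + 4 * ((M : ℝ) ^ 2 * ((M : ℝ) ^ d * M) * S) + 4 * T) →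
      (M : ℝ) ^ 2 * (M : ℝ) ^ d * A ≤ (M : ℝ) ^ 2 * (M : ℝ) ^ d * ((M : ℝ) ^ 2 * O) + 4 * ((M : ℝ) ^ 2 * ((M : ℝ) ^ d * M) * S) + 4 * T :=
    fun A O S T h => le_of_mul_le_mul_left h hn
  refine e1 _ _ _ _ ?_
  linarith [hsum]

/-! ## §2 Gauge covariance of the comb line sum, and the flat-vs-covariant gradient in the HS currency -/

/-- The `κ`-last comb transports transform as transports do: `combTransport (W^u) M z κ v i = u(M•z) · combTransport W M z κ v i · u(M•z+v+i•e_κ)⁻¹`.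
[folklore] -/
theorem combTransport_gaugeAct (u : Site d → (Matrix n n ℂ)ˣ) (W : Site d → Fin d → (Matrix n n ℂ)ˣ) (M : ℕ) (z : Site d)
    (κ : Fin d) (v : Site d) (i : ℕ) :
    combTransport (gaugeAct u W) M z κ v i
      = u ((M : ℤ) • z) * combTransport W M z κ v i * (u ((M : ℤ) • z + v + (i : ℤ) • e κ))⁻¹ := by
  unfold combTransport
  rw [hol_gaugeAct, disp_klastWord, ← add_assoc]

/-- **GAUGE COVARIANCE OF THE CORNER-READ COMB LINE SUM**: for every gauge transformation `u`,
`TWg M (combFrame (W^u) M) (η^u) z κ = Ad (u (M•z)) (TWg M (combFrame W M) η z κ)` (`η^u = dirGauge u η`): the copy at step `i`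
lives at the end `M•z+v+(i+1)•e_κ` of its bond, where the `u`-factors of the transport and of `η^u` cancel.  Hence
`nhsNormSq (TWc …)` is gauge invariant. [folklore] -/
theorem TWg_combFrame_gaugeAct (u : Site d → (Matrix n n ℂ)ˣ) (W : Site d → Fin d → (Matrix n n ℂ)ˣ) (M : ℕ)
    (η : Site d → Fin d → Matrix n n ℂ) (z : Site d) (κ : Fin d) :
    TWg M (combFrame (gaugeAct u W) M) (dirGauge u η) z κ = Ad (u ((M : ℤ) • z)) (TWg M (combFrame W M) η z κ) := by
  unfold TWg
  rw [Ad_sum]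
  refine sum_congr rfl fun v _ => ?_
  rw [Ad_sum]
  refine sum_congr rfl fun i _ => ?_
  rw [Ad_combFrame_inv, Ad_combFrame_inv, combTransport_gaugeAct]
  simp only [dirGauge]
  have hx : (M : ℤ) • z + v + (i : ℤ) • e κ + e κ = (M : ℤ) • z + v + ((i + 1 : ℕ) : ℤ) • e κ := by
    push_cast; rw [add_smul, one_smul, add_assoc]
  rw [hx, ← Ad_mul, mul_assoc, inv_mul_cancel, mul_one, Ad_mul]

/-- The gauge invariance of `nhsNormSq (TWg M (combFrame W M) η z κ)` (unitary `u`). [folklore] -/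
theorem nhsNormSq_TWg_combFrame_gaugeAct {u : Site d → (Matrix n n ℂ)ˣ} (hu : ∀ y, u y ∈ unitaryUnits (Matrix n n ℂ))
    (W : Site d → Fin d → (Matrix n n ℂ)ˣ) (M : ℕ) (η : Site d → Fin d → Matrix n n ℂ) (z : Site d) (κ : Fin d) :
    nhsNormSq (TWg M (combFrame (gaugeAct u W) M) (dirGauge u η) z κ) = nhsNormSq (TWg M (combFrame W M) η z κ) := by
  rw [TWg_combFrame_gaugeAct, nhsNormSq_Ad (hu _)]

/-- … with `‖P − 1‖ ≤ β`: `‖X − Ad_P X‖²_HS ≤ 4β²·‖X‖²_HS`. [folklore] -/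
theorem nhsNormSq_sub_Ad_le [Nonempty n] {P : (Matrix n n ℂ)ˣ} (hP : P ∈ unitaryUnits (Matrix n n ℂ)) (X : Matrix n n ℂ)
    {β : ℝ} (hβ : ‖(P : Matrix n n ℂ) - 1‖ ≤ β) : nhsNormSq (X - Ad P X) ≤ 4 * β ^ 2 * nhsNormSq X := by
  have h1 := nhsNormSq_Ad_sub_le hP X
  rw [← nhsNormSq_neg, neg_sub] at h1
  have hb : ‖(P : Matrix n n ℂ) - 1‖ ^ 2 ≤ β ^ 2 := pow_le_pow_left₀ (norm_nonneg _) hβ 2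
  have hX := nhsNormSq_nonneg X
  nlinarith [h1, hb, hX]

/-- `‖X + Y‖²_HS ≤ 2(‖X‖²_HS + ‖Y‖²_HS)`. [folklore] -/
theorem nhsNormSq_add_le (X Y : Matrix n n ℂ) : nhsNormSq (X + Y) ≤ 2 * (nhsNormSq X + nhsNormSq Y) := by
  have h := nhsNormSq_sub_le X (-Y)
  rwa [sub_neg_eq_add, nhsNormSq_neg] at h

/-- **THE FLAT FORWARD DIFFERENCE AGAINST THE COVARIANT ONE, HS CURRENCY** (the pointwise twin of leaf-03-g6's
`NE3NearIdentityGradient.nhsNormSq_fd_le` with HS remainders — no operator norm of `ψ`, no `card n`): if the bond variables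
`V(x,μ)`, `V(x+e_μ,ν)`, `V(x,ν)` are `α`-close to `1`, then
`‖ψ(x+e_μ)ν − ψ x ν‖²_HS ≤ 2‖covFd V ψ x μ ν‖²_HS + 64α²‖ψ(x+e_μ)ν‖²_HS + 16α²‖ψ x ν‖²_HS`. [folklore] -/
theorem nhsNormSq_fd_le_hs [Nonempty n] {V : Site d → Fin d → (Matrix n n ℂ)ˣ} (hV : IsUnitaryCfg V)
    (ψ : Site d → Fin d → Matrix n n ℂ) (x : Site d) (μ ν : Fin d) {α : ℝ}
    (h₁ : ‖(V x μ : Matrix n n ℂ) - 1‖ ≤ α) (h₂ : ‖(V (x + e μ) ν : Matrix n n ℂ) - 1‖ ≤ α) (h₃ : ‖(V x ν : Matrix n n ℂ) - 1‖ ≤ α) :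
    nhsNormSq (ψ (x + e μ) ν - ψ x ν)
      ≤ 2 * nhsNormSq (covFd V ψ x μ ν) + 64 * α ^ 2 * nhsNormSq (ψ (x + e μ) ν) + 16 * α ^ 2 * nhsNormSq (ψ x ν) := by
  set D₁ : Matrix n n ℂ := ψ (x + e μ) ν - Ad (V x μ * V (x + e μ) ν) (ψ (x + e μ) ν) with hD₁
  set D₂ : Matrix n n ℂ := ψ x ν - Ad (V x ν) (ψ x ν) with hD₂
  have hsplit : ψ (x + e μ) ν - ψ x ν = covFd V ψ x μ ν + (D₁ - D₂) := by
    simp only [hD₁, hD₂, covFd]; abel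
  have hP : ‖((V x μ * V (x + e μ) ν : (Matrix n n ℂ)ˣ) : Matrix n n ℂ) - 1‖ ≤ 2 * α := by
    refine (norm_mul_sub_one_le (hV _ _)).trans ?_
    linarith
  have hD₁b : nhsNormSq D₁ ≤ 4 * (2 * α) ^ 2 * nhsNormSq (ψ (x + e μ) ν) :=
    nhsNormSq_sub_Ad_le ((unitaryUnits _).mul_mem (hV _ _) (hV _ _)) _ hP
  have hD₂b : nhsNormSq D₂ ≤ 4 * α ^ 2 * nhsNormSq (ψ x ν) := nhsNormSq_sub_Ad_le (hV _ _) _ h₃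
  rw [hsplit]
  have hA := nhsNormSq_add_le (covFd V ψ x μ ν) (D₁ - D₂)
  have hB := nhsNormSq_sub_le D₁ D₂
  nlinarith [hA, hB, hD₁b, hD₂b, nhsNormSq_nonneg (covFd V ψ x μ ν)]

/-- … THROUGH A UNITARY GAUGE: with `V^u = gaugeAct u V`, `ψ^u = dirGauge u ψ` and the three GAUGE-FIXED bonds `α`-close to `1`,
`‖ψ^u(x+e_μ)ν − ψ^u x ν‖²_HS ≤ 2‖covFd V ψ x μ ν‖²_HS + 64α²‖ψ(x+e_μ)ν‖²_HS + 16α²‖ψ x ν‖²_HS` (`covFd_gaugeAct`, `nhsNormSq_Ad`).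
[folklore] -/
theorem nhsNormSq_fd_dirGauge_le_hs [Nonempty n] {V : Site d → Fin d → (Matrix n n ℂ)ˣ} (hV : IsUnitaryCfg V)
    {u : Site d → (Matrix n n ℂ)ˣ} (hu : ∀ y, u y ∈ unitaryUnits (Matrix n n ℂ))
    (ψ : Site d → Fin d → Matrix n n ℂ) (x : Site d) (μ ν : Fin d) {α : ℝ}
    (h₁ : ‖((gaugeAct u V x μ : (Matrix n n ℂ)ˣ) : Matrix n n ℂ) - 1‖ ≤ α)
    (h₂ : ‖((gaugeAct u V (x + e μ) ν : (Matrix n n ℂ)ˣ) : Matrix n n ℂ) - 1‖ ≤ α)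
    (h₃ : ‖((gaugeAct u V x ν : (Matrix n n ℂ)ˣ) : Matrix n n ℂ) - 1‖ ≤ α) :
    nhsNormSq (dirGauge u ψ (x + e μ) ν - dirGauge u ψ x ν)
      ≤ 2 * nhsNormSq (covFd V ψ x μ ν) + 64 * α ^ 2 * nhsNormSq (ψ (x + e μ) ν) + 16 * α ^ 2 * nhsNormSq (ψ x ν) := by
  have hVu : IsUnitaryCfg (gaugeAct u V) := SpreadLiftDirection.isUnitaryCfg_gaugeAct' hu hV
  have h := nhsNormSq_fd_le_hs hVu (dirGauge u ψ) x μ ν h₁ h₂ h₃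
  rw [covFd_gaugeAct, nhsNormSq_Ad (hu _)] at h
  simp only [dirGauge, nhsNormSq_Ad (hu _)] at h ⊢
  exact h

/-! ## §3 The `κ`-first comb gauge of row C0 (file 3): the `κ`-last comb transports of the gauge-fixed background -/

section CombGauge

variable [Nonempty n] {M : ℕ} {W : Site d → Fin d → (Matrix n n ℂ)ˣ} {a : ℝ}

omit [Nonempty n] in
/-- In the `κ`-first comb gauge `u = lcomb κ M W z` the transverse tree at the corner height is trivial:
`W^u(M•z; treeWord t) = 1` for `t κ = 0` (there `lineWord κ t = treeWord t`). [folklore] -/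
theorem hol_lcombGauge_treeWord_eq_one (κ : Fin d) (M : ℕ) (W : Site d → Fin d → (Matrix n n ℂ)ˣ) (z : Site d) {t : Site d}
    (ht : t κ = 0) : hol (gaugeAct (lcomb κ M W z) W) ((M : ℤ) • z) (treeWord t) = 1 := by
  rw [hol_gaugeAct, disp_treeWord, lcomb_corner, one_mul]
  have h : lcomb κ M W z ((M : ℤ) • z + t) = hol W ((M : ℤ) • z) (treeWord t) := by
    unfold lcomb lineWord
    rw [add_sub_cancel_left, ht, zero_smul, sub_zero]
    rfl
  rw [h, mul_inv_cancel]

/-- **THE `κ`-SEGMENTS OF THE GAUGE-FIXED BACKGROUND**: for unitary small-field `W`, `M ≥ 1`, a transverse offset `t ≥ 0`, `t κ = 0`,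
`t j ≤ M − 1`, and every `m`, `‖W^u(M•z + t; seg κ m) − 1‖ ≤ m·(d−1)(M−1)·a` (`u = lcomb κ M W z`; bond by bond through C0's
`norm_lcombGauge_sub_one_le`, uniform along the `κ`-line). [folklore] -/
theorem norm_hol_lcombGauge_seg_sub_one_le (hW : IsUnitaryCfg W) (hWa : SmallField W a) (hM : 1 ≤ M) (ha : 0 ≤ a)
    (κ : Fin d) (z : Site d) {t : Site d} (ht0 : 0 ≤ t) (htj : ∀ j, j ≠ κ → t j ≤ (M : ℤ) - 1) :
    ∀ m : ℕ, ‖((hol (gaugeAct (lcomb κ M W z) W) ((M : ℤ) • z + t) (seg κ (m : ℤ)) : (Matrix n n ℂ)ˣ) : Matrix n n ℂ) - 1‖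
      ≤ m * (((d : ℝ) - 1) * ((M : ℝ) - 1) * a)
  | 0 => by simp
  | m + 1 => by
    have ih := norm_hol_lcombGauge_seg_sub_one_le hW hWa hM ha κ z ht0 htj m
    have hW' : IsUnitaryCfg (gaugeAct (lcomb κ M W z) W) := isUnitaryCfg_lcombGauge (M := M) hW κ z
    have hx : (M : ℤ) • z ≤ (M : ℤ) • z + t + (m : ℤ) • e κ := by
      intro j
      have := ht0 j
      simp only [Pi.add_apply, Pi.smul_apply, e_apply, smul_eq_mul, Pi.zero_apply] at this ⊢
      split_ifs <;> nlinarith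
    have hxt : ∀ j, j ≠ κ → ((M : ℤ) • z + t + (m : ℤ) • e κ - (M : ℤ) • z) j ≤ (M : ℤ) - 1 := by
      intro j hj
      have := htj j hj
      simp only [Pi.add_apply, Pi.sub_apply, Pi.smul_apply, e_apply, if_neg hj, smul_eq_mul, mul_zero, add_zero,
        add_sub_cancel_left]
      exact this
    have hb := norm_lcombGauge_sub_one_le hW hWa hM ha κ z hx hxt κ
    rw [show ((m + 1 : ℕ) : ℤ) = (m : ℤ) + 1 by push_cast; ring, hol_seg_succ]
    calc _ ≤ ‖((hol (gaugeAct (lcomb κ M W z) W) ((M : ℤ) • z + t) (seg κ (m : ℤ)) : (Matrix n n ℂ)ˣ) : Matrix n n ℂ) - 1‖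
          + ‖((gaugeAct (lcomb κ M W z) W ((M : ℤ) • z + t + (m : ℤ) • e κ) κ : (Matrix n n ℂ)ˣ) : Matrix n n ℂ) - 1‖ :=
          norm_mul_sub_one_le (hW' _ _)
      _ ≤ m * (((d : ℝ) - 1) * ((M : ℝ) - 1) * a) + ((d : ℝ) - 1) * ((M : ℝ) - 1) * a := add_le_add ih hb
      _ = ((m + 1 : ℕ) : ℝ) * (((d : ℝ) - 1) * ((M : ℝ) - 1) * a) := by push_cast; ring

/-- **THE `κ`-LAST COMB TRANSPORTS OF THE GAUGE-FIXED BACKGROUND ARE `2M(d−1)(M−1)a`-CLOSE TO `1`**: for `v ∈ [0,M)^d`, `i < M`,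
`‖combTransport (W^u) M z κ v (i+1) − 1‖ ≤ 2M·(d−1)(M−1)·a` (`u = lcomb κ M W z`: the transverse tree is trivial, the `κ`-segment of
length `v κ + i + 1 ≤ 2M` costs `(d−1)(M−1)a` per bond). [folklore] -/
theorem norm_combTransport_lcombGauge_sub_one_le (hW : IsUnitaryCfg W) (hWa : SmallField W a) (hM : 1 ≤ M) (ha : 0 ≤ a)
    (κ : Fin d) (z : Site d) {v : Site d} (hv : v ∈ periodBox (d := d) M) {i : ℕ} (hi : i < M) :
    ‖((combTransport (gaugeAct (lcomb κ M W z) W) M z κ v (i + 1) : (Matrix n n ℂ)ˣ) : Matrix n n ℂ) - 1‖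
      ≤ 2 * M * (((d : ℝ) - 1) * ((M : ℝ) - 1) * a) := by
  rw [mem_periodBox] at hv
  set t : Site d := v - v κ • e κ with htdef
  have htκ : t κ = 0 := transverse_apply_self κ v
  have ht0 : 0 ≤ t := by
    intro j
    by_cases hj : j = κ
    · subst hj; rw [Pi.zero_apply, htκ]
    · rw [htdef, transverse_apply_ne κ v hj]; exact (hv j).1
  have htj : ∀ j, j ≠ κ → t j ≤ (M : ℤ) - 1 := by
    intro j hj
    rw [htdef, transverse_apply_ne κ v hj]
    have := (hv j).2
    omega
  obtain ⟨vk, hvk⟩ := Int.eq_ofNat_of_zero_le (hv κ).1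
  have hvkM : vk < M := by have := (hv κ).2; omega
  have hword : combTransport (gaugeAct (lcomb κ M W z) W) M z κ v (i + 1)
      = hol (gaugeAct (lcomb κ M W z) W) ((M : ℤ) • z + t) (seg κ ((vk + (i + 1) : ℕ) : ℤ)) := by
    unfold combTransport klastWord
    rw [hol_append, disp_treeWord, ← htdef, hol_lcombGauge_treeWord_eq_one κ M W z htκ, one_mul, hvk]
    push_cast
    rfl
  rw [hword]
  refine (norm_hol_lcombGauge_seg_sub_one_le hW hWa hM ha κ z ht0 htj (vk + (i + 1))).trans ?_
  have hc : 0 ≤ ((d : ℝ) - 1) * ((M : ℝ) - 1) * a := by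
    have hd : (1 : ℝ) ≤ d := by exact_mod_cast Nat.one_le_of_lt (Fin.pos κ)
    have hM1 : (1 : ℝ) ≤ M := by exact_mod_cast hM
    have : 0 ≤ ((d : ℝ) - 1) * ((M : ℝ) - 1) := mul_nonneg (by linarith) (by linarith)
    exact mul_nonneg this ha
  refine mul_le_mul_of_nonneg_right ?_ hc
  have : vk + (i + 1) ≤ 2 * M := by omega
  exact_mod_cast this

/-- The far `κ`-bonds one layer beyond a transverse face: for `v ∈ [0,M)^d` and every `μ`,
`‖W^u(M•z + v + e_μ, κ) − 1‖ ≤ (d−1)·M·a` (`u = lcomb κ M W z`; for `μ ≠ κ` the transverse residue may reach `M`, whence `M` for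
`M − 1`). [folklore] -/
theorem norm_lcombGauge_far_sub_one_le (hW : IsUnitaryCfg W) (hWa : SmallField W a) (hM : 1 ≤ M) (ha : 0 ≤ a)
    (κ : Fin d) (z : Site d) {v : Site d} (hv : v ∈ periodBox (d := d) M) (μ : Fin d) :
    ‖((gaugeAct (lcomb κ M W z) W ((M : ℤ) • z + v + e μ) κ : (Matrix n n ℂ)ˣ) : Matrix n n ℂ) - 1‖ ≤ ((d : ℝ) - 1) * M * a := by
  rw [mem_periodBox] at hv
  have hd : (1 : ℝ) ≤ d := by exact_mod_cast Nat.one_le_of_lt (Fin.pos κ)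
  have hM1 : (1 : ℝ) ≤ M := by exact_mod_cast hM
  have hx : (M : ℤ) • z ≤ (M : ℤ) • z + v + e μ := by
    intro j
    have := (hv j).1
    simp only [Pi.add_apply, Pi.smul_apply, e_apply, smul_eq_mul]
    split_ifs <;> linarith
  by_cases hμ : μ = κ
  · subst hμ
    have hxt : ∀ j, j ≠ μ → ((M : ℤ) • z + v + e μ - (M : ℤ) • z) j ≤ (M : ℤ) - 1 := by
      intro j hj
      have := (hv j).2
      simp only [Pi.add_apply, Pi.sub_apply, Pi.smul_apply, e_apply, if_neg hj, add_zero, add_sub_cancel_left]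
      omega
    refine (norm_lcombGauge_sub_one_le hW hWa hM ha μ z hx hxt μ).trans ?_
    have : ((d : ℝ) - 1) * ((M : ℝ) - 1) ≤ ((d : ℝ) - 1) * M := by nlinarith
    nlinarith
  · refine (norm_lcombGauge_sub_one_le_self hW hWa κ z hx).trans ?_
    set w : Site d := (M : ℤ) • z + v + e μ - ((M : ℤ) • z + ((M : ℤ) • z + v + e μ - (M : ℤ) • z) κ • e κ) with hw
    have hwj : ∀ j, w j = if j = κ then 0 else v j + (if j = μ then 1 else 0) := by
      intro j
      rw [hw]
      simp only [Pi.sub_apply, Pi.add_apply, Pi.smul_apply, e_apply, smul_eq_mul]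
      by_cases hj : j = κ
      · subst hj; simp
      · simp only [if_neg hj, mul_zero, add_zero]; ring
    have hw0 : 0 ≤ w := by
      intro j; rw [Pi.zero_apply, hwj]
      have := (hv j).1
      split_ifs <;> linarith
    have hwκ : w κ = 0 := by rw [hwj]; simp
    have hwM : ∀ j, j ≠ κ → w j ≤ ((M + 1 : ℕ) : ℤ) - 1 := by
      intro j hj; rw [hwj, if_neg hj]
      have := (hv j).2
      split_ifs <;> push_cast <;> omega
    have hl1 := l1_transverse_le κ (M := M + 1) (by omega) hw0 hwκ hwM
    push_cast at hl1
    calc (l1 w : ℝ) * a ≤ (((d : ℝ) - 1) * ((M : ℝ) + 1 - 1)) * a := mul_le_mul_of_nonneg_right hl1 ha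
      _ = ((d : ℝ) - 1) * M * a := by ring

end CombGauge

end

end Summit.QuantumFields.BalabanUV.T4Continuum.NE3CovariantLineSumCore
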